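import Mathlib.CategoryTheory.Sigma.Basic
import Mathlib.CategoryTheory.Functor.FullyFaithful
import HarnessLib

/-!
# Frobenioids II, §0: grafting of categories and the coproduct category

Mochizuki, *The geometry of Frobenioids II: poly-Frobenioids*, Kyushu J. Math. **62** (2008)
401–460, §0 "Notations and Conventions", paragraph **Categories**, author's text p. 6
[cite: MochizukiFrdII2008, §0 p.6] (companion of `Dissection.lean`, which holds pp. 5–6 up to the
ordered monomorphisms).

**Contents.**
* the category `C ⊣_E D` obtained by *grafting* `D` onto `C` via functors `Φ : C → E`, `Ψ : D → E`:
  objects = objects of `C` or of `D`; arrows inside `C`, inside `D` ("homogeneous"), from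
  `B ∈ Ob(D)` to `A ∈ Ob(C)` the arrows `Ψ(B) → Φ(A)` of `E` ("heterogeneous"), none from `C` to `D`;
  "composition … in the evident fashion"; the natural full embeddings `C ↪ C ⊣_E D ↩ D`;
* the coproduct category `∐ᵢ Cᵢ` (= Mathlib's category structure on `Σ i, C i`) with its inclusions.

**Design.** `C`, `D`, `E` are taken with a common morphism universe `v` (the hom-types of the graft
are hom-types of `C`, `D` or `E` verbatim). Deliberately NOT here: the functor `∐ Cᵢ → ∏ Cᵢ^⊤`
(p. 6; it is not used in §§1–3 of [FrdII], the part cited by IUT I–IV), and §5 (poly-Frobenioids),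
where grafting is applied.
-/

namespace Literature.AlgebraicGeometry.Frobenioids

open CategoryTheory

universe w v u u₁ u₂ u₃

/-! ### Grafting `C ⊣_E D` (p. 6) -/

section Graft

variable {C : Type u₁} [Category.{v} C] {D : Type u₂} [Category.{v} D] {E : Type u₃} [Category.{v} E]

/-- The objects of the category `C ⊣_E D` obtained by *grafting* `D` onto `C` via `Φ : C → E`,
`Ψ : D → E`: "objects of `C` or objects of `D`" (FrdII §0 p. 6). [cite: MochizukiFrdII2008, §0 p.6] -/
inductive Graft (Φ : C ⥤ E) (Ψ : D ⥤ E) : Type (max u₁ u₂)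
  /-- an object of `C` -/
  | left (A : C) : Graft Φ Ψ
  /-- an object of `D` -/
  | right (B : D) : Graft Φ Ψ

namespace Graft

variable {Φ : C ⥤ E} {Ψ : D ⥤ E}

/-- Arrows of `C ⊣_E D`: between objects of `C` (resp. `D`) the arrows of `C` (resp. `D`)
("homogeneous"); from `B ∈ Ob(D)` to `A ∈ Ob(C)` the arrows `Ψ(B) → Φ(A)` of `E` ("heterogeneous");
none from an object of `C` to an object of `D` (FrdII §0 p. 6). [cite: MochizukiFrdII2008, §0 p.6] -/
def Hom : Graft Φ Ψ → Graft Φ Ψ → Type v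
  | left A, left A' => A ⟶ A'
  | right B, right B' => B ⟶ B'
  | right B, left A => Ψ.obj B ⟶ Φ.obj A
  | left _, right _ => PEmpty

/-- Identities of `C ⊣_E D`. [cite: MochizukiFrdII2008, §0 p.6] -/
def id : ∀ X : Graft Φ Ψ, Hom X X
  | left A => 𝟙 A
  | right B => 𝟙 B

/-- "Composition of morphisms is defined in the evident fashion" (FrdII §0 p. 6): inside `C` and `D`
as given, and a heterogeneous arrow is composed with homogeneous ones through `Φ`, `Ψ`.
[cite: MochizukiFrdII2008, §0 p.6] -/
def comp : ∀ {X Y Z : Graft Φ Ψ}, Hom X Y → Hom Y Z → Hom X Z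
  | left _, left _, left _, f, g => (f ≫ g : _ ⟶ _)
  | right _, right _, right _, f, g => (f ≫ g : _ ⟶ _)
  | right _, right _, left _, f, g => (Ψ.map f ≫ g : _ ⟶ _)
  | right _, left _, left _, f, g => (f ≫ Φ.map g : _ ⟶ _)
  | left _, right _, _, f, _ => f.elim
  | right _, left _, right _, _, g => g.elim
  | left _, left _, right _, _, g => g.elim

/-- `C ⊣_E D` is a category (FrdII §0 p. 6). [cite: MochizukiFrdII2008, §0 p.6] -/
instance instCategory : Category.{v} (Graft Φ Ψ) where
  Hom := Hom
  id := id
  comp := comp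
  id_comp := by
    rintro (_ | _) (_ | _) f
    · exact Category.id_comp (obj := C) f
    · exact f.elim
    · change Ψ.map (𝟙 _) ≫ f = f
      rw [Ψ.map_id]; exact Category.id_comp (obj := E) f
    · exact Category.id_comp (obj := D) f
  comp_id := by
    rintro (_ | _) (_ | _) f
    · exact Category.comp_id (obj := C) f
    · exact f.elim
    · change f ≫ Φ.map (𝟙 _) = f
      rw [Φ.map_id]; exact Category.comp_id (obj := E) f
    · exact Category.comp_id (obj := D) f
  assoc := by
    rintro (_ | _) (_ | _) (_ | _) (_ | _) f g h <;>
      first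
      | exact f.elim
      | exact g.elim
      | exact h.elim
      | exact Category.assoc (obj := C) f g h
      | exact Category.assoc (obj := D) f g h
      | (change Ψ.map (f ≫ g) ≫ h = Ψ.map f ≫ (Ψ.map g ≫ h); rw [Ψ.map_comp, Category.assoc])
      | (change (f ≫ Φ.map g) ≫ Φ.map h = f ≫ Φ.map (g ≫ h); rw [Φ.map_comp, Category.assoc])
      | exact Category.assoc (obj := E) _ _ _

/-- An arrow of `C ⊣_E D` is *homogeneous* if its domain and codomain lie in the same one of `C`, `D`
(FrdII §0 p. 6). [cite: MochizukiFrdII2008, §0 p.6] -/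
def IsHomogeneous : ∀ {X Y : Graft Φ Ψ}, (X ⟶ Y) → Prop
  | left _, left _, _ => True
  | right _, right _, _ => True
  | right _, left _, _ => False
  | left _, right _, _ => False

/-- An arrow of `C ⊣_E D` is *heterogeneous* if it goes from an object of `D` to an object of `C`
(FrdII §0 p. 6). [cite: MochizukiFrdII2008, §0 p.6] -/
def IsHeterogeneous {X Y : Graft Φ Ψ} (f : X ⟶ Y) : Prop := ¬ IsHomogeneous f

/-- "If `A ∈ Ob(C)`, `B ∈ Ob(D)`, then there are no morphisms `A → B`" (FrdII §0 p. 6).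
[cite: MochizukiFrdII2008, §0 p.6] -/
instance isEmpty_hom_left_right (A : C) (B : D) : IsEmpty ((left A : Graft Φ Ψ) ⟶ right B) :=
  ⟨fun f => PEmpty.elim f⟩

variable (Φ Ψ)

/-- The natural full embedding `C ↪ C ⊣_E D` (FrdII §0 p. 6). [cite: MochizukiFrdII2008, §0 p.6] -/
def inl : C ⥤ Graft Φ Ψ where
  obj := left
  map f := f

/-- The natural full embedding `D ↪ C ⊣_E D` (FrdII §0 p. 6). [cite: MochizukiFrdII2008, §0 p.6] -/
def inr : D ⥤ Graft Φ Ψ where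
  obj := right
  map f := f

/-- `C ↪ C ⊣_E D` is fully faithful ("so we may regard `C` as a full subcategory", FrdII §0 p. 6).
[cite: MochizukiFrdII2008, §0 p.6] -/
def inlFullyFaithful : (inl Φ Ψ).FullyFaithful where
  preimage f := f

/-- `D ↪ C ⊣_E D` is fully faithful ("so we may regard `D` as a full subcategory", FrdII §0 p. 6).
[cite: MochizukiFrdII2008, §0 p.6] -/
def inrFullyFaithful : (inr Φ Ψ).FullyFaithful where
  preimage f := f

/-- `C ↪ C ⊣_E D` is full. [cite: MochizukiFrdII2008, §0 p.6] -/
instance : (inl Φ Ψ).Full := (inlFullyFaithful Φ Ψ).full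

/-- `C ↪ C ⊣_E D` is faithful. [cite: MochizukiFrdII2008, §0 p.6] -/
instance : (inl Φ Ψ).Faithful := (inlFullyFaithful Φ Ψ).faithful

/-- `D ↪ C ⊣_E D` is full. [cite: MochizukiFrdII2008, §0 p.6] -/
instance : (inr Φ Ψ).Full := (inrFullyFaithful Φ Ψ).full

/-- `D ↪ C ⊣_E D` is faithful. [cite: MochizukiFrdII2008, §0 p.6] -/
instance : (inr Φ Ψ).Faithful := (inrFullyFaithful Φ Ψ).faithful

/-- A heterogeneous arrow `B → A` of `C ⊣_E D` is, by definition, an arrow `Ψ(B) → Φ(A)` of `E`.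
[cite: MochizukiFrdII2008, §0 p.6] -/
def heteroEquiv (A : C) (B : D) : ((right B : Graft Φ Ψ) ⟶ left A) ≃ (Ψ.obj B ⟶ Φ.obj A) :=
  Equiv.refl _

end Graft

end Graft

/-! ### The coproduct category `∐ᵢ Cᵢ` (p. 6) -/

section Coprod

/-- `∐_{i ∈ I} Cᵢ`: the category whose objects are objects of one of the `Cᵢ` and whose arrows
`A → B` are the arrows of `Cᵢ` when `A, B ∈ Ob(Cᵢ)`, none otherwise (FrdII §0 p. 6) — Mathlib's
category structure on the sigma type `Σ i, C i` (`CategoryTheory.Sigma`).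
[cite: MochizukiFrdII2008, §0 p.6] -/
abbrev coprodCat {I : Type w} (C : I → Type u) [∀ i, Category.{v} (C i)] : Type (max w u) := Σ i, C i

/-- The inclusion `Cᵢ ⥤ ∐ᵢ Cᵢ`. [cite: MochizukiFrdII2008, §0 p.6] -/
abbrev coprodIncl {I : Type w} (C : I → Type u) [∀ i, Category.{v} (C i)] (i : I) :
    C i ⥤ coprodCat C :=
  Sigma.incl i

end Coprod

end Literature.AlgebraicGeometry.Frobenioids
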